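import Summits.AnomalousDissipation.AnomalousDissipation.Theorems.SolenoidalFractalHomogenisationLagrangianStepVmodFrameDefs
import Summits.AnomalousDissipation.AnomalousDissipation.Theorems.SolenoidalFractalHomogenisationLagrangianStepVmodDistortedAssembly
import HarnessLib

/-!
# K1L_D (stmt-AnomalousDissipation-27980), (ℓ3-A) road A: the ASSEMBLY over the class of record —
# `VmodDist.modECW0F_of_blockBoundsGF_at : NearMultGF κ (κ<1) + 4 × BlockBoundGF ⇒ SlowVectorClauseModECW0F` (p712075 VERBATIM over the F-texts;
# tenure RULING D28-10 (a); certifier 3-probe PASS; prover lead-k1l-onelevel-p1 g7; helper, `--supports 27980 --as helper`)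

D28-9 CONDITION: the texts are reset-anchored (`U 0 t`, `T 0 t`); the flat (ℓ2) inputs of the block proofs are the `s = 0` / grid-phase instances.
No sorry, no definition, no named fact.  NOT a proof of any block, of (M_θ), of `stub_Vmod_EHTthg`, of K1L_D or AD; rung F-D1.A0.
-/

set_option linter.dupNamespace false

noncomputable section

namespace Summit.AnomalousDissipation.AnomalousDissipation.Theorems.SolenoidalFractalHomogenisation.LagrangianStep.VmodDist

open Literature.Analysis Literature.Analysis.FluidPDE Literature.Analysis.FunctionSpaces
open MeasureTheory Set
open scoped InnerProductSpace
open Summit.AnomalousDissipation.AnomalousDissipation.Theorems.SolenoidalFractalHomogenisation.LagrangianStep.CellClauseMod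
open Summit.AnomalousDissipation.AnomalousDissipation.Theorems.SolenoidalFractalHomogenisation.LagrangianStep.LossCurrency
open Summit.AnomalousDissipation.AnomalousDissipation.Theorems.SolenoidalFractalHomogenisation.LagrangianStep.VmodFlat
  (IsSlow IsFast fc fc_sub inner_eq_zero_of_fc_disjoint eta_sum_le)

/-! ## §4 The (ℓ3-A) assembly over the class of record (p712075 VERBATIM with the F-texts) -/

set_option maxHeartbeats 1600000 in
/-- **(ℓ3-A) ASSEMBLY over the class of record**: `NearMultGF` (`0 ≤ κ < 1`) and the four `BlockBoundGF` give `SlowVectorClauseModECW0F` with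
`Cm = (C₁ + C₂ + C₃ + C₄)/(1 − κ)`.  Proof = `modECW0_of_blockBoundsG_at` verbatim (the modulation datum is only passed through). -/
theorem modECW0F_of_blockBoundsGF_at {k : ℕ} (W : LatticeShear.LatticeWord k) (M : ℝ) (hM : 0 < M) {c : ℝ}
    (Φ : ℝ → Torus.Visc4 (Fin 3) → Torus.Visc4 (Fin 3)) {lo hi Λ β σ' C₁ C₂ C₃ C₄ ν₀ K θ₁ ϱ₁ κ : ℝ}
    (hκ0 : 0 ≤ κ) (hκ : κ < 1) (hC₁ : 0 ≤ C₁) (hC₂ : 0 ≤ C₂) (hC₃ : 0 ≤ C₃) (hC₄ : 0 ≤ C₄)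
    (hNM : NearMultGF c Φ lo hi Λ β ν₀ K θ₁ ϱ₁ κ)
    (B₁ : BlockBoundGF W M hM c Φ lo hi Λ β σ' C₁ ν₀ K θ₁ ϱ₁ IsSlow IsSlow) (B₂ : BlockBoundGF W M hM c Φ lo hi Λ β σ' C₂ ν₀ K θ₁ ϱ₁ IsSlow IsFast)
    (B₃ : BlockBoundGF W M hM c Φ lo hi Λ β σ' C₃ ν₀ K θ₁ ϱ₁ IsFast IsSlow) (B₄ : BlockBoundGF W M hM c Φ lo hi Λ β σ' C₄ ν₀ K θ₁ ϱ₁ IsFast IsFast) :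
    SlowVectorClauseModECW0F W M hM c Φ lo hi Λ β σ' ((C₁ + C₂ + C₃ + C₄) / (1 - κ)) ν₀ K θ₁ ϱ₁ := by
  intro ν hν n hn 𝔸 hodd hwin hΦo hΦw θ hθ nC hnC0 hnC Tw hTw G hG U T hU hT t ht0 htT x ζ
  -- the split at the frequency ball `freqBall (n/4)`
  set A : Set (Fin 3 → ℤ) := ↑(Torus.freqBall (d := Fin 3) (n / 4)) with hA
  have hAsym : ∀ k', k' ∈ A ↔ -k' ∈ A := fun k' => by
    rw [hA, Finset.mem_coe, Finset.mem_coe, Torus.neg_mem_freqBall]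
  obtain ⟨P, hP⟩ := exists_labelProj A hAsym
  have hPoff : ∀ (y : V2) (k' : Fin 3 → ℤ), k' ∉ Torus.freqBall (d := Fin 3) (n / 4) → fc (P y) k' = 0 := by
    intro y k' hk'
    have h := hP y k'
    rw [if_neg (by rwa [hA, Finset.mem_coe] : k' ∉ A)] at h
    exact h
  have hPon : ∀ (y : V2) (k' : Fin 3 → ℤ), k' ∈ Torus.freqBall (d := Fin 3) (n / 4) → fc (P y) k' = fc y k' := by
    intro y k' hk'
    have h := hP y k'
    rw [if_pos (by rwa [hA, Finset.mem_coe] : k' ∈ A)] at h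
    exact h
  set xs : V2 := P x with hxs
  set xf : V2 := x - P x with hxf
  set ζs : V2 := P ζ with hζs
  set ζf : V2 := ζ - P ζ with hζf
  have hx : x = xs + xf := by rw [hxs, hxf]; abel
  have hζ : ζ = ζs + ζf := by rw [hζs, hζf]; abel
  have slow_of : ∀ y : V2, IsSlow n (P y) := fun y k' hk' => hPoff y k' hk'
  have fast_of : ∀ y : V2, IsFast n (y - P y) := fun y k' hk' => by
    rw [fc_sub, hPon y k' hk', sub_self]
  have hxs_s : IsSlow n xs := slow_of x
  have hxf_f : IsFast n xf := fast_of x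
  have hζs_s : IsSlow n ζs := slow_of ζ
  have hζf_f : IsFast n ζf := fast_of ζ
  -- slow and fast pieces are Fourier-disjoint, hence orthogonal
  have disj : ∀ {y y' : V2}, IsSlow n y → IsFast n y' → ∀ k', fc y k' = 0 ∨ fc y' k' = 0 := by
    intro y y' hy hy' k'
    by_cases hk' : k' ∈ Torus.freqBall (d := Fin 3) (n / 4)
    · exact Or.inr (hy' k' hk')
    · exact Or.inl (hy k' hk')
  have hox : ⟪xs, xf⟫_ℝ = 0 := inner_eq_zero_of_fc_disjoint (disj hxs_s hxf_f)
  have hoζ : ⟪ζs, ζf⟫_ℝ = 0 := inner_eq_zero_of_fc_disjoint (disj hζs_s hζf_f)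
  -- the coarse member: contraction, nonnegative losses, near-multiplier cross bounds
  have hTc : ∀ y, ‖T 0 t y‖ ≤ ‖y‖ := hT.norm_le 0 t
  have hq0 : ∀ y, 0 ≤ lossFwd (T 0 t) y := fun y => loss_nonneg hTc y
  have hqs0 : ∀ y, 0 ≤ lossAdj (T 0 t) y := fun y => lossAdj_nonneg hTc y
  obtain ⟨hNMf, hNMa⟩ := hNM ν hν n hn 𝔸 hodd hwin hΦo hΦw θ hθ nC hnC0 hnC Tw hTw G hG T hT t ht0 htT
  have hsplit : lossFwd (T 0 t) xs + lossFwd (T 0 t) xf ≤ lossFwd (T 0 t) x / (1 - κ) := by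
    unfold lossFwd; rw [hx]
    exact loss_split_le_of_nearMult (T 0 t) hκ0 hκ hox (hq0 xs) (hq0 xf) (hNMf xs xf hxs_s hxf_f)
  have hsplitA : lossAdj (T 0 t) ζs + lossAdj (T 0 t) ζf ≤ lossAdj (T 0 t) ζ / (1 - κ) := by
    unfold lossAdj; rw [hζ]
    have hTa : ∀ y, ‖ContinuousLinearMap.adjoint (T 0 t) y‖ ≤ ‖y‖ := norm_adjoint_le hTc
    exact loss_split_le_of_nearMult (ContinuousLinearMap.adjoint (T 0 t)) hκ0 hκ hoζ (loss_nonneg hTa ζs) (loss_nonneg hTa ζf)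
      (hNMa ζs ζf hζs_s hζf_f)
  -- the four block bounds at the pieces
  have b₁₁ := B₁ ν hν n hn 𝔸 hodd hwin hΦo hΦw θ hθ nC hnC0 hnC Tw hTw G hG U T hU hT t ht0 htT xs ζs hxs_s hζs_s
  have b₁₂ := B₂ ν hν n hn 𝔸 hodd hwin hΦo hΦw θ hθ nC hnC0 hnC Tw hTw G hG U T hU hT t ht0 htT xs ζf hxs_s hζf_f
  have b₂₁ := B₃ ν hν n hn 𝔸 hodd hwin hΦo hΦw θ hθ nC hnC0 hnC Tw hTw G hG U T hU hT t ht0 htT xf ζs hxf_f hζs_s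
  have b₂₂ := B₄ ν hν n hn 𝔸 hodd hwin hΦo hΦw θ hθ nC hnC0 hnC Tw hTw G hG U T hU hT t ht0 htT xf ζf hxf_f hζf_f
  -- common currency
  set a : ℝ := ν ^ σ' + ((⌈K / ν⌉₊ : ℝ) / n) ^ σ' + θ ^ σ' + (nC / n) ^ σ' with ha_def
  set m : ℝ := (min 1 ((M * W.period / ν) / t)) ^ σ' with hm_def
  have ha0 : 0 ≤ a := by
    have h1 : 0 ≤ ν ^ σ' := Real.rpow_nonneg hν.1.le σ'
    have h2 : 0 ≤ ((⌈K / ν⌉₊ : ℝ) / n) ^ σ' := Real.rpow_nonneg (by positivity) σ'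
    have h3 : 0 ≤ θ ^ σ' := Real.rpow_nonneg hθ.1 σ'
    have h4 : 0 ≤ (nC / n) ^ σ' := Real.rpow_nonneg (div_nonneg hnC0 (Nat.cast_nonneg n)) σ'
    rw [ha_def]; linarith
  have hP0 : 0 ≤ (M * W.period / ν) / t :=
    div_nonneg (div_nonneg (mul_nonneg hM.le
      (Summit.AnomalousDissipation.AnomalousDissipation.Theorems.SolenoidalFractalHomogenisation.PermissibleCarrier.period_pos W).le) hν.1.le) ht0.le
  have hm0 : 0 ≤ m := by rw [hm_def]; exact Real.rpow_nonneg (le_min zero_le_one hP0) σ'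
  have hη0 : ∀ {Cb : ℝ}, 0 ≤ Cb → 0 ≤ Cb * (Cb * a + m) := fun hCb => mul_nonneg hCb (by positivity)
  -- bilinear expansion and the 2×2 bookkeeping with `A² = q(x)/(1−κ)`, `B² = q*(ζ)/(1−κ)`
  have hκ1 : 0 < 1 - κ := by linarith
  have hlin : U 0 t x - T 0 t x = (U 0 t xs - T 0 t xs) + (U 0 t xf - T 0 t xf) := by
    rw [hx, map_add, map_add]; abel
  have key := lossBound_add_blocks (v₁ := U 0 t xs - T 0 t xs) (v₂ := U 0 t xf - T 0 t xf) (ζ₁ := ζs) (ζ₂ := ζf)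
    (A := Real.sqrt (lossFwd (T 0 t) x / (1 - κ))) (B := Real.sqrt (lossAdj (T 0 t) ζ / (1 - κ)))
    b₁₁ b₁₂ b₂₁ b₂₂ (hη0 hC₁) (hη0 hC₂) (hη0 hC₃) (hη0 hC₄)
    (Real.sqrt_nonneg _) (Real.sqrt_nonneg _) (Real.sqrt_nonneg _) (Real.sqrt_nonneg _)
    (by rw [Real.sq_sqrt (hq0 xs), Real.sq_sqrt (hq0 xf), Real.sq_sqrt (div_nonneg (hq0 x) hκ1.le)]; exact hsplit)
    (by rw [Real.sq_sqrt (hqs0 ζs), Real.sq_sqrt (hqs0 ζf), Real.sq_sqrt (div_nonneg (hqs0 ζ) hκ1.le)]; exact hsplitA)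
  rw [hlin, hζ]
  refine key.trans ?_
  rw [← hζ]
  have hsum := eta_sum_le (m := m) hC₁ hC₂ hC₃ hC₄ ha0
  -- `√(q/(1−κ))·√(q*/(1−κ)) = √q·√q*/(1−κ)` and `(ΣC)((ΣC)a + m)/(1−κ) ≤ Cm(Cm a + m)`, `Cm = ΣC/(1−κ)`
  set S : ℝ := C₁ + C₂ + C₃ + C₄ with hS
  have hS0 : 0 ≤ S := by rw [hS]; linarith
  have hsq : Real.sqrt (lossFwd (T 0 t) x / (1 - κ)) * Real.sqrt (lossAdj (T 0 t) ζ / (1 - κ))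
      = (Real.sqrt (lossFwd (T 0 t) x) * Real.sqrt (lossAdj (T 0 t) ζ)) / (1 - κ) := by
    rw [Real.sqrt_div' _ hκ1.le, Real.sqrt_div' _ hκ1.le, div_mul_div_comm, Real.mul_self_sqrt hκ1.le]
  have hXY : 0 ≤ Real.sqrt (lossFwd (T 0 t) x) * Real.sqrt (lossAdj (T 0 t) ζ) := by positivity
  have hinv1 : 1 ≤ 1 / (1 - κ) := by rw [le_div_iff₀ hκ1]; linarith
  have hCm : S * (S * a + m) / (1 - κ) ≤ S / (1 - κ) * (S / (1 - κ) * a + m) := by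
    rw [div_eq_mul_one_div S, show S * (S * a + m) / (1 - κ) = S * (1 / (1 - κ)) * (S * a + m) by ring]
    refine mul_le_mul_of_nonneg_left ?_ (by positivity)
    have : S * a ≤ S * (1 / (1 - κ)) * a := by
      have := mul_le_mul_of_nonneg_left hinv1 (mul_nonneg hS0 ha0)
      nlinarith [this]
    linarith
  calc (C₁ * (C₁ * a + m) + C₂ * (C₂ * a + m) + C₃ * (C₃ * a + m) + C₄ * (C₄ * a + m))
        * Real.sqrt (lossFwd (T 0 t) x / (1 - κ)) * Real.sqrt (lossAdj (T 0 t) ζ / (1 - κ))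
      = (C₁ * (C₁ * a + m) + C₂ * (C₂ * a + m) + C₃ * (C₃ * a + m) + C₄ * (C₄ * a + m))
        * (Real.sqrt (lossFwd (T 0 t) x / (1 - κ)) * Real.sqrt (lossAdj (T 0 t) ζ / (1 - κ))) := by ring
    _ ≤ (S * (S * a + m)) * (Real.sqrt (lossFwd (T 0 t) x / (1 - κ)) * Real.sqrt (lossAdj (T 0 t) ζ / (1 - κ))) :=
          mul_le_mul_of_nonneg_right hsum (by positivity)
    _ = (S * (S * a + m) / (1 - κ)) * (Real.sqrt (lossFwd (T 0 t) x) * Real.sqrt (lossAdj (T 0 t) ζ)) := by rw [hsq]; ring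
    _ ≤ (S / (1 - κ) * (S / (1 - κ) * a + m)) * (Real.sqrt (lossFwd (T 0 t) x) * Real.sqrt (lossAdj (T 0 t) ζ)) :=
          mul_le_mul_of_nonneg_right hCm hXY
    _ = S / (1 - κ) * (S / (1 - κ) * a + m) * Real.sqrt (lossFwd (T 0 t) x) * Real.sqrt (lossAdj (T 0 t) ζ) := by ring

end Summit.AnomalousDissipation.AnomalousDissipation.Theorems.SolenoidalFractalHomogenisation.LagrangianStep.VmodDist

end
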